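import Summits.CriticalPhenomena.PercolationContinuityZ3.Theorems.Transplant.SkelPhiCellsWeakG
import Summits.CriticalPhenomena.PercolationContinuityZ3.Theorems.Transplant.SkelPhiCellsConcGLevels
import HarnessLib

/-!
# N1 ({±1} node) scheme geometry over a NON-STEP cell map, part 2 (hp-8 g33; design owner's assignment 2026-08-21 13:26Z): `ExitGeom`, `StepsGeom`,
# `LevelGeom`, `QSepGeom` for the record `Skelφ.cellGeomSG₂` (far region `EfarN₂`) under `Lip` + `WeakSteps` — companion of `SkelPhiCellsWeakG`

builds on p205010 (kernel theorem, internal audit signed; external expert review pending) — nothing in this file uses p205010; nothing here is a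
claim about the open node `SamePDropOfSkeletonNeg`.
Lane `prim-bschramm`, seat `prim-hp-8` (gen 33); helper file (`--supports stmt-CriticalPhenomena-4575 --as helper`).
WHAT CHANGES against `SkelPhiCellsConcGLevels` §5–§6 (p2-g7): `StepsGeom.Hfull_subset` uses a WEAK step into a slack box (down into `Q_v` from the base rows,
up into `EfarN₂` above them) instead of the step device; the far region is `EfarN₂` throughout (`mem_VWin_EfarN₂_of_adj`, `M ⊆ EfarN₂`, separations by
`SepInf.mono`); `ExitGeom` and `QSepGeom` are the source's text with `φ ↦ ψ`.
* `exitGeomSG₂ (hlip)`, **`stepsGeomSG₂ (hlip) (hws)`**, `mem_VWin_EfarN₂_of_adj`, **`levelGeomSG₂ (hlip)`**, `qSepGeomSG₂ (hlip)`.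
[cite: KozmaNitzan2024, §4 pp. 26–27, 30–31 (E_{v,x}, H^j_{v,x}, F^j_{v,x}, Step IV)] [cite: MartineauTassion2017, §4.3]
-/

noncomputable section

open scoped Classical

namespace Summit.CriticalPhenomena.PercolationContinuityZ3.Theorems

namespace Transplant

namespace Skelφ

open Literature.Probability.Percolation Literature.Probability.LatticeModels SimpleGraph KNCells
open Literature.Probability.Percolation.KozmaNitzan
open Literature.Probability.Percolation.KozmaNitzan.Cells (oth oth_ne sgOf sgOf_sign stepVec_apply_fst stepVec_apply_oth eq_oth_of_ne oth_oth)
open Literature.Barriers.CriticalPhenomena (graphBall graphBall_finite mem_graphBall_self graphBall_mono)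
open BoxProdZ2 (ConcRadiiG)
open PlanarSkeletonConc (mem_vspan_edgesIn_iff mem_vspan_edgesIn_of_adj)

variable {V : Type} [DecidableEq V] {G : SimpleGraph V} [G.LocallyFinite] {ψ : V → Site 2}

section Records

variable (P : PCells2) (w₀ : V) {Λ : ConcRadiiG} (hΛ : WFS2 P Λ)

/-! ## §5 `ExitGeom`, `StepsGeom` -/

include hΛ in
/-- **`ExitGeom`** (`locFin` from (lip): a neighbour of `y` inside `E_{w,δ}` pins the macro-vertex `w + δ` within `35 r_i + 1` of `ψ y i`) — the source's
text. [cite: KozmaNitzan2024, §4 pp. 26–27] -/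
theorem exitGeomSG₂ (hlip : Lip G ψ) : ExitGeom G (cellGeomSG₂ G ψ P w₀ Λ) where
  M_subset_Q a v := VWin_mono (P.M_subset_Q v) (let h := hΛ.rM_le_rE_le_rQ a v; h.1.trans h.2)
  Cell_disjoint_Q a a' u x hux := disjoint_VWin (P.Cell_disjoint_Q hux) _ _
  Zone_disjoint_Q a a' u δ x := disjoint_VWin (P.Zone_disjoint_Q u δ x) _ _
  locFin y := by
    set B : Site 2 := fun i => |ψ y i| + 35 * P.r i + 1 with hB
    refine (Finset.Icc (-B) B).finite_toSet.subset ?_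
    rintro v ⟨a, w, δ, rfl, b, hb, hadj⟩
    change b ∈ VWin G ψ w₀ (P.BtwN w δ) (Λ.rB a w δ) ∪ VWin G ψ w₀ (P.Q (w + stepVec δ)) (Λ.rQ a (w + stepVec δ)) at hb
    have hb2 : ψ b ∈ P.EwvN w δ := by
      rw [PCells2.EwvN, Finset.mem_union]
      rcases Finset.mem_union.1 hb with h | h
      · exact Or.inl (φ_mem_of_mem_VWin h)
      · exact Or.inr (φ_mem_of_mem_VWin h)
    have hnear : ∀ i, |ψ b i - ψ y i| ≤ 1 := fun i => by
      rw [abs_sub_comm]; exact hlip hadj i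
    rw [Finset.coe_Icc, Set.mem_Icc]
    have key : ∀ i, |(w + stepVec δ) i| ≤ B i := by
      intro i
      have h1 := P.sub_cen_le_of_mem_EwvN hb2 i
      have h2 := hnear i
      rw [abs_le] at h1 h2 ⊢
      simp only [PCells2.cen_apply] at h1
      simp only [hB]
      have hy := abs_nonneg (ψ y i)
      have hy' := le_abs_self (ψ y i)
      have hy'' := neg_abs_le (ψ y i)
      have hr : (1 : ℤ) ≤ P.r i := by exact_mod_cast P.one_le_r i
      constructor <;> nlinarith
    exact ⟨fun i => (abs_le.1 (key i)).1, fun i => (abs_le.1 (key i)).2⟩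

include hΛ in
/-- **`StepsGeom`** (faces ⊆ stubs ⊆ corridor; corridor ⊆ `Q_a ∪ EfarN₂_{a'}` by a WEAK step into a slack box; target cube ⊆ far box), under (lip) and
weak steps. [cite: KozmaNitzan2024, §4 pp. 26, 30] -/
theorem stepsGeomSG₂ (hlip : Lip G ψ) (hws : WeakSteps G ψ) : StepsGeom (cellGeomSG₂ G ψ P w₀ Λ) (faceDataSG G ψ P w₀ Λ) where
  Face_subset_Stub _ _ _ _ := Finset.filter_subset _ _
  Stub_subset_Hfull a v δ j hj := VStair_mono (P.Stub_subset_Hfull v δ (by change j ≤ P.K at hj; exact hj)) fun _ _ => le_rfl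
  Hfull_subset a a' v δ ha' := by
    intro y hy
    change y ∈ VStair G ψ w₀ (P.Hfull v δ) (prof P Λ a' v δ) at hy
    change y ∈ VWin G ψ w₀ (P.Q v) (Λ.rQ a v) ∪ VWin G ψ w₀ (P.EfarN₂ v δ) (Λ.rE a' v δ)
    obtain ⟨hP, hd⟩ := mem_of_mem_VStair hy
    obtain ⟨htr, hl, hu⟩ := P.bounds_of_mem_Hfull hP
    have hr : (1 : ℤ) ≤ P.r δ.1 := by exact_mod_cast P.one_le_r δ.1
    by_cases hlev : P.lev δ v (ψ y) ≤ 5 * P.r δ.1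
    · -- base rows: down-step into the cube
      obtain ⟨m, hadj, h1, h2, h3⟩ := exists_adj_downBox hlip hws P δ v y
      have hyQ : ψ y ∈ P.Q v := P.downBox_subset_Q (htr.trans (by omega)) (by omega) hlev le_rfl (by omega) (by simp)
      have hmQ : ψ m ∈ P.Q v := P.downBox_subset_Q (htr.trans (by omega)) (by omega) hlev h1 h2 h3
      exact Finset.mem_union_left _ (mem_VWin_of_adj hd (hΛ.ρQ1 a a' v δ _ ha' hlev) hyQ hadj hmQ)
    · -- above the base rows: up-step into the slack far region
      obtain ⟨m, hadj, h1, h2, h3⟩ := exists_adj_upBox hlip hws P δ v y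
      have hyE : ψ y ∈ P.EfarN₂ v δ := P.upBox_subset_EfarN₂ htr (by omega) (by omega) le_rfl (by omega) (by simp)
      have hmE : ψ m ∈ P.EfarN₂ v δ := P.upBox_subset_EfarN₂ htr (by omega) (by omega) h1 h2 h3
      exact Finset.mem_union_right _ (mem_VWin_of_adj hd (hΛ.ρE1 a' v δ _) hyE hadj hmE)
  M_tgt_subset_Efar a v δ := VWin_mono (P.M_add_stepVec_subset_EfarN₂ v δ) (hΛ.ME a v δ)

/-! ## §6 `LevelGeom` (staircase levels, the slack far region) and `QSepGeom` -/

/-- An inside edge of a staircase over `H` (or a subset) starting at planar level `≥ 5r∥ + 2` is an inside edge of the window over `EfarN₂`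
(profile `≤ rE`). [this work] -/
theorem mem_VWin_EfarN₂_of_adj (hlip : Lip G ψ) {P : PCells2} {w₀ : V} {Λ : ConcRadiiG} (hW : WF2 P Λ) {a : ℕ} {v : Site 2} {δ : MDir}
    {Pl : Finset (Site 2)} (hPH : Pl ⊆ P.Hfull v δ) {y z : V} (hy : y ∈ stair G ψ w₀ Pl (prof P Λ a v δ))
    (hz : z ∈ stair G ψ w₀ Pl (prof P Λ a v δ)) (hadj : G.Adj y z) (hl : 5 * (P.r δ.1 : ℤ) + 2 ≤ P.lev δ v (ψ y)) :
    y ∈ VWin G ψ w₀ (P.EfarN₂ v δ) (Λ.rE a v δ) := by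
  rw [mem_stair] at hy hz
  have hlz : 5 * (P.r δ.1 : ℤ) + 1 ≤ P.lev δ v (ψ z) := by
    have := lev_le_lev_add_one_of_adj hlip P v hadj.symm (δ := δ); omega
  have hyE : ψ y ∈ P.EfarN₂ v δ := by
    by_contra hn; have := P.lev_le_of_mem_Hfull_not_EfarN₂' (hPH hy.1) hn; omega
  have hzE : ψ z ∈ P.EfarN₂ v δ := by
    by_contra hn; have := P.lev_le_of_mem_Hfull_not_EfarN₂' (hPH hz.1) hn; omega
  refine (mem_vspan_edgesIn_of_adj ?_ ?_ hadj).1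
  · exact (mem_Win G ψ).2 ⟨graphBall_mono G w₀ (hW.ρE a v δ _) hy.2, hyE⟩
  · exact (mem_Win G ψ).2 ⟨graphBall_mono G w₀ (hW.ρE a v δ _) hz.2, hzE⟩

include hΛ in
/-- **`LevelGeom`** over a (non-step) planar map with the two-unit narrow boxes, the slack far region, the level shift and the STAIRCASE levels —
the source's text with `EfarN₂`. [cite: KozmaNitzan2024, §4 p. 31 (Step IV)] -/
theorem levelGeomSG₂ (hlip : Lip G ψ) : LevelGeom G (cellGeomSG₂ G ψ P w₀ Λ) (faceDataSG G ψ P w₀ Λ) (levelDataS ψ P) where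
  adj_le a' v δ y z h := by
    change P.stairLev δ.1 (P.lev δ v (ψ z)) ≤ P.stairLev δ.1 (P.lev δ v (ψ y)) + 1
    exact P.stairLev_le_add_one δ.1 (lev_le_lev_add_one_of_adj hlip P v h)
  lev_Q a a' v δ _ y hy := by
    change P.stairLev δ.1 (P.lev δ v (ψ y)) ≤ 1
    refine P.stairLev_le_one_of_le δ.1 ?_
    have := P.lev_le_of_mem_Q (δ := δ) (φ_mem_of_mem_VWin hy); omega
  lev_Hfull a' v δ y hy hn := by
    change P.stairLev δ.1 (P.lev δ v (ψ y)) ≤ 1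
    change y ∉ VWin G ψ w₀ (P.EfarN₂ v δ) (Λ.rE a' v δ) at hn
    by_contra hlt
    have h2 := P.base_add_two_le_of_two_le_stairLev δ.1 (show (2 : ℤ) ≤ P.stairLev δ.1 (P.lev δ v (ψ y)) by omega)
    obtain ⟨hyS, z, hz, hadj⟩ := mem_vspan_edgesIn_iff.1 hy
    exact hn (mem_VWin_EfarN₂_of_adj hlip hΛ.toWF2 subset_rfl hyS hz hadj h2)
  ℓQ_lt j hj := by
    change (1 : ℤ) < 2 * (j : ℤ)
    have : (1 : ℤ) ≤ j := by exact_mod_cast hj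
    omega
  mem_Stub a' v δ j _ _ y hy hl := by
    change P.stairLev δ.1 (P.lev δ v (ψ y)) ≤ 2 * (j : ℤ) at hl
    obtain ⟨hyS, z, hz, hadj⟩ := mem_vspan_edgesIn_iff.1 hy
    exact mem_VStair_Stub_of_adj hlip hyS hz hadj (P.le_faceRow_of_stairLev_le δ.1 hl)
  mem_Face a' v δ j _ _ y hy hl := by
    change P.stairLev δ.1 (P.lev δ v (ψ y)) = 2 * (j : ℤ) at hl
    have hl' := P.eq_faceRow_of_stairLev_eq δ.1 hl
    obtain ⟨hyS, z, hz, hadj⟩ := mem_vspan_edgesIn_iff.1 hy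
    exact Finset.mem_filter.2 ⟨mem_VStair_Stub_of_adj hlip hyS hz hadj hl'.le, hl'⟩
  Face_far a' v δ j hjK t ht := by
    obtain ⟨htS, hl⟩ := Finset.mem_filter.1 ht
    have hs1 : (1 : ℤ) ≤ P.s δ.1 := by exact_mod_cast P.hs δ.1
    refine ⟨?_, ?_⟩
    · change t ∈ VWin G ψ w₀ (P.EfarN₂ v δ) (Λ.rE a' v δ)
      obtain ⟨htS', z, hz, hadj⟩ := mem_vspan_edgesIn_iff.1 htS
      refine mem_VWin_EfarN₂_of_adj hlip hΛ.toWF2 (P.Stub_subset_Hfull v δ hjK) htS' hz hadj ?_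
      rw [hl]; push_cast; nlinarith
    · change 2 * (j : ℤ) + 1 ≤ P.stairLev δ.1 (P.lev δ v (ψ t))
      rw [hl, P.stairLev_faceRow δ.1 (j + 1)]; push_cast; omega
  M_far a' v δ t ht := by
    have hl := P.lev_ge_of_mem_M_add (δ := δ) (φ_mem_of_mem_VWin ht)
    have hrK : (P.r δ.1 : ℤ) = P.K * P.s δ.1 := P.r_eq δ.1
    refine ⟨VWin_mono (P.M_add_stepVec_subset_EfarN₂ v δ) (hΛ.ME a' v δ) ht, ?_⟩
    change 2 * ((P.K : ℕ) : ℤ) + 1 ≤ P.stairLev δ.1 (P.lev δ v (ψ t))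
    refine P.stairLev_ge_of_face_le δ.1 ?_
    nlinarith
  Btw_sep_Efar a a' w δw du hdu := by
    change KNCells.Sep G (VWin G ψ w₀ (P.BtwN w δw) (Λ.rB a w δw)) (VWin G ψ w₀ (P.EfarN₂ (w + stepVec δw) du) (Λ.rE a' (w + stepVec δw) du))
    rw [← P.BtwN_rev' w δw]
    exact sep_VWin_of_sepInf hlip ((P.BtwN_sepInf_EfarN (w + stepVec δw) (Ne.symm hdu)).mono subset_rfl
      (Finset.coe_subset.2 (P.EfarN₂_subset_EfarN _ _))) _ _
  Cell_sep_Efar b a' u v δ huv hux :=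
    sep_VWin_of_sepInf hlip ((P.Cell_sepInf_EfarN huv hux).mono subset_rfl (Finset.coe_subset.2 (P.EfarN₂_subset_EfarN _ _))) _ _
  Zone_sep_Efar b a' u δ' v δ huv hux :=
    sep_VWin_of_sepInf hlip ((P.Zone_sepInf_EfarN huv hux δ').mono subset_rfl (Finset.coe_subset.2 (P.EfarN₂_subset_EfarN _ _))) _ _

/-- **`QSepGeom`** (cells and zones of other macro-vertices against the cube; wide boxes), from (lip). [cite: KozmaNitzan2024, §4 p. 26 ((29))] -/
theorem qSepGeomSG₂ (hlip : Lip G ψ) : QSepGeom G (cellGeomSG₂ G ψ P w₀ Λ) where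
  Cell_sep_Q _ _ _ _ hux := sep_VWin_of_sepInf hlip (P.Cell_sepInf_Q hux) _ _
  Zone_sep_Q _ _ u δ x _ := sep_VWin_of_sepInf hlip (P.Zone_sepInf_Q u δ x) _ _

end Records

end Skelφ

end Transplant

end Summit.CriticalPhenomena.PercolationContinuityZ3.Theorems

end
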